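import Literature.AlgebraicGeometry.Motives.HodgeStructurePontryaginInteriorProduct
import Literature.AlgebraicGeometry.Motives.HodgeStructureExteriorAlgebraSelfAdjoint
import HarnessLib

/-!
# The dual Lefschetz operator is the Pontryagin product with the curve class: `Λ_ω x = x ⋆ ω^{g−1}/(g−1)!` on `H•(X) = ⋀W`
# (Lieberman–Kleiman: on an abelian variety `Λ_θ` is induced by an algebraic correspondence, the standard conjecture `B(A)`),
# through `θ(θ^{[g−1]}) = Φ(ω^∨)` — the Poincaré dual of the curve class `θ^{g−1}/(g−1)!` is the 2-cycle `Φ(Σᵢ eᵢ* ∧ fᵢ*)`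

[topic AlgebraicGeometry/Motives]

Layer `Literature/AlgebraicGeometry/Motives`, lane `lit-hodgefound` (Track 2 foundations library; prover seat `lit-hodgefound-p34`,
generation 36, row g36-#8). THEOREMS ONLY (no definition, no named fact, no instance, no notation; net debt `0`). Sequel of rows
g29-#1/g30 (`HodgeStructureExteriorPowerLefschetz(Dual)`, `HodgeStructureExteriorAlgebraSelfAdjoint`: `Λ_ω = lefschetzDual ω g = Σᵢ i(fᵢ*) i(eᵢ*)`
in any Darboux basis, `Λ(ω^{j+1}) = (j+1)(g−j) ωʲ`, and `τ(Λx ∧ y) = τ(x ∧ Λy)`), g35-#2 (`HodgeStructurePontryaginProduct`: `x ⋆ y =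
μ_*(Φ(x ⊗ y))`, PROP. 2.5.13 `θ(x ⋆ y) = (−1)^{pq} θ(x) ⋆ θ(y)` for the Poincaré duality `θ(x) = τ(· ∧ x) : H•(X) → H_•(X) = (⋀W)^∨`,
`θ([0]) = ε`), g36-#3 (Pontryagin's theorem `Φ : ⋀(W^∨) ⥲ (⋀W)^∨`) and g36-#7 (`HodgeStructurePontryaginInteriorProduct`: `Ψ ∘ Λ_ω = Φ(ω^∨) ⋆ Ψ`,
`ω^∨ = twoVector b.dualBasis = Σᵢ eᵢ* ∧ fᵢ*`).

THE ARGUMENT (no coordinates beyond row g36-#7). Write `[0] = ω^g/g!` (the point class, `θ([0]) = ε` the unit of `(H_•, ⋆)`) and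
`D = ω^{g−1}/(g−1)! = Λ[0]` (the curve class `θ^{g−1}/(g−1)!` of a principal polarization `θ = ω`). Then
`θ(D) = θ(Λ[0]) = θ([0]) ∘ Λ = ε ∘ Λ = Φ(ω^∨) ⋆ ε = Φ(ω^∨)` (self-adjointness of `Λ`, row g36-#7 §4, unit law) — §1: THE POINCARÉ DUAL
OF THE CURVE CLASS IS THE 2-CYCLE `Φ(ω^∨)`. Hence for `x ∈ ⋀ᵖW`: `θ(Λx) = θ(x) ∘ Λ = Φ(ω^∨) ⋆ θ(x) = θ(D) ⋆ θ(x) = θ(D ⋆ x) = θ(x ⋆ D)`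
(Prop. 2.5.13 with the even degree `2g − 2` of `D`, graded commutativity), and `θ` is injective (Poincaré duality) — §2:
**`Λ_ω x = x ⋆ ω^{g−1}/(g−1)!` FOR EVERY `x ∈ H•(X)`**. On an abelian variety with principal polarization `θ` this says that Grothendieck's
operator `Λ_θ` is the correspondence "Pontryagin product with the algebraic 1-cycle `θ^{g−1}/(g−1)!`" — Lieberman's theorem that the
standard conjecture of Lefschetz type `B(A)` holds for abelian varieties ("is known for abelian varieties (Lieberman 1968, Kleiman 1968)",
Milne 2002 p. 600), in explicit form.

## Sources, VERBATIM

J. S. Milne, *Polarizations and Grothendieck's standard conjectures*, Ann. of Math. 155 (2002) [Milne2002Polarizations] (held text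
`paper:milne2002-polarizations-grothendieck-s-standard-conjectures`, p0002 = p. 600): "[the standard conjecture of Lefschetz type] is known
for abelian varieties (Lieberman 1968, Kleiman 1968), surfaces and […]".
C. Voisin, *Hodge Theory and Complex Algebraic Geometry I* [Voisin2002], §6.2.1 Lemma 6.19 (the operator `Λ` in a symplectic basis;
row g29-#1 `lefschetzDual_eq_lam`: `Λ = Σᵢ i(fᵢ*) i(eᵢ*)`).
H. Lange, *Abelian Varieties over the Complex Numbers* (2023) [Lange2023AbelianVarietiesComplex], §2.5.3 Prop. 2.5.13 (p0134: the Pontryagin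
product is dual to `μ^*`), Lemma 2.5.12 (p0133: `H_• ≅ ⋀H_1`), §1.1 Exercise 1.1.6 (11) (p0027–p0028: `⋆ = μ_* ∘ ×`); §4.? is not used —
the curve class `θ^{g−1}/(g−1)!` enters only as `Λ[0]` (`Λ(ω^{j+1}) = (j+1)(g−j) ωʲ`, Huybrechts Prop. 1.2.30, row g29-#1 `lefschetzDual_pow_succ`).

## What is proved (all `theorem`s; `ω` symplectic of genus `g ≥ 1`, `b` any Darboux basis of `ω`)

* §1 `IsSymplectic.lefschetzDual_inv_factorial_smul_pow` (`Λ[0] = D`, i.e. `Λ(ω^g/g!) = ω^{g−1}/(g−1)!`) and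
  **`IsSymplectic.trace_comp_mulRight_inv_factorial_smul_pow_pred`: `θ(ω^{g−1}/(g−1)!) = Φ(twoVector b.dualBasis)`** — the Poincaré dual
  `τ(· ∧ D)` of the curve class is the 2-cycle `Φ(Σᵢ eᵢ* ∧ fᵢ*) ∈ H_2` (for EVERY Darboux basis `b`; in particular `Φ(ω^∨)` does not
  depend on `b`).
* §2 **`IsSymplectic.lefschetzDual_apply_eq_pontryagin`: `Λ_ω x = x ⋆ (ω^{g−1}/(g−1)!)` for every `x`**, the operator form
  `IsSymplectic.lefschetzDual_eq_flip_pontryagin` (`Λ_ω = (· ⋆ D)`), and `IsSymplectic.lefschetzDual_apply_eq_pontryagin'` (`Λ_ω x = D ⋆ x`).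

Not here: the corresponding statement for `L = ω ∧ ·` on homology (`Ψ ∘ L` = interior product by `ω` on `⋀(W^∨)` under `Φ`), and
Beauville's Fourier transform. TWIN NOTICE (RULING 29 bis): the Kähler torus-forms carrier has its own `ComplexTorusPoincareFormula` /
`…KunnethProjectorsAlgebraic` files — BY NAME, nothing imported or restated; the present file is the abstract-`⋀W` statement.

## References

* [Milne2002Polarizations] J. S. Milne, *Polarizations and Grothendieck's standard conjectures*, Ann. of Math. (2) 155 (2002), 599–610, p. 600.
* [Voisin2002] C. Voisin, *Hodge Theory and Complex Algebraic Geometry I* (2002), §6.2.1 Lemma 6.19.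
* [Lange2023AbelianVarietiesComplex] H. Lange, *Abelian Varieties over the Complex Numbers* (2023), §1.1 Exercise 1.1.6 (11) (p0027–p0028);
  §2.5.3 Lemma 2.5.12, Prop. 2.5.13 (p0133–p0134).
* [Huybrechts2005] D. Huybrechts, *Complex Geometry* (2005), Prop. 1.2.30 (proof: `Λ Lʲ` on primitive strings).
* [BourbakiAlgebraI1989] N. Bourbaki, *Algebra I*, Ch. III §11 no. 9 (interior products).
-/

noncomputable section

open scoped TensorProduct Nat

namespace Literature.AlgebraicGeometry.Motives

namespace ExteriorLefschetz

open ExteriorAlgebra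

variable {K : Type*} [Field K] [CharZero K] {W : Type*} [AddCommGroup W] [Module K W] {ω : ExteriorAlgebra K W} {g : ℕ}

/-! ## §1 `Λ[0] = D` and `θ(D) = Φ(ω^∨)` for the curve class `D = ω^{g−1}/(g−1)!` -/

/-- **`Λ(ω^g/g!) = ω^{g−1}/(g−1)!`**: the dual Lefschetz operator takes the point class to the curve class (`Λ(ω^g) = g · ω^{g−1}`,
row g29-#1 `lefschetzDual_pow_succ` with `j = g − 1`, and `g! = g · (g−1)!`). [cite: Huybrechts2005, Prop. 1.2.30 (proof)]
[cite: Voisin2002, §6.2.1 Lemma 6.19] -/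
theorem IsSymplectic.lefschetzDual_inv_factorial_smul_pow (hω : IsSymplectic ω g) (hg : 0 < g) :
    lefschetzDual ω g ((g ! : K)⁻¹ • ω ^ g) = ((g - 1)! : K)⁻¹ • ω ^ (g - 1) := by
  obtain ⟨k, rfl⟩ : ∃ k, g = k + 1 := ⟨g - 1, (Nat.sub_add_cancel hg).symm⟩
  rw [map_smul, hω.lefschetzDual_pow_succ k, smul_smul, Nat.add_sub_cancel]
  congr 1
  have hk : ((k : K) + 1) ≠ 0 := by exact_mod_cast Nat.succ_ne_zero k
  rw [Nat.factorial_succ, Nat.cast_mul, Nat.cast_add, Nat.cast_one, add_sub_cancel_left, mul_one, mul_inv, mul_assoc, mul_comm ((k ! : ℕ) : K)⁻¹,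
    ← mul_assoc, inv_mul_cancel₀ hk, one_mul]

/-- **`θ(ω^{g−1}/(g−1)!) = Φ(ω^∨)` — THE POINCARÉ DUAL OF THE CURVE CLASS IS THE 2-CYCLE `Φ(Σᵢ eᵢ* ∧ fᵢ*)`**: for every Darboux basis `b`
of `ω` (`ω = Σᵢ eᵢ ∧ fᵢ`), `τ(· ∧ ω^{g−1}/(g−1)!) = Φ(twoVector b.dualBasis)` in `H_2(X) ⊂ (⋀W)^∨`. Proof without coordinates:
`θ(D) = θ(Λ[0])`, `θ(Λ[0])(z) = τ(z ∧ Λ[0]) = τ(Λz ∧ [0]) = (θ[0] ∘ Λ)(z)` (self-adjointness of `Λ`), `θ[0] = ε`, and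
`ε ∘ Λ = Φ(ω^∨) ⋆ ε = Φ(ω^∨)` (row g36-#7 §4, unit law). [cite: Lange2023AbelianVarietiesComplex, §2.5.3 Prop. 2.5.13 (p0134) and Lemma 2.5.12 (p0133)]
[cite: Voisin2002, §6.2.1 Lemma 6.19] [cite: BourbakiAlgebraI1989, Ch. III §11 no. 9] -/
theorem IsSymplectic.trace_comp_mulRight_inv_factorial_smul_pow_pred (hω : IsSymplectic ω g) (hg : 0 < g)
    (b : Module.Basis (Fin g ⊕ Fin g) K W) (hb : ω = twoVector b) :
    trace ω g ∘ₗ LinearMap.mulRight K (((g - 1)! : K)⁻¹ • ω ^ (g - 1)) = pontryaginMap K W (twoVector b.dualBasis) := by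
  rw [← hω.lefschetzDual_inv_factorial_smul_pow hg, ← dualConv_algebraMapInv_right (pontryaginMap K W (twoVector b.dualBasis)),
    ← hω.comp_lefschetzDual_eq_dualConv b hb, ← hω.trace_comp_mulRight_point_eq_algebraMapInv]
  refine LinearMap.ext fun z ↦ ?_
  rw [LinearMap.comp_apply, LinearMap.mulRight_apply, LinearMap.comp_apply, LinearMap.comp_apply, LinearMap.mulRight_apply,
    hω.trace_lefschetzDual_mul hg]

/-! ## §2 `Λ_ω x = x ⋆ ω^{g−1}/(g−1)!` -/

/-- **LIEBERMAN–KLEIMAN IN EXPLICIT FORM: `Λ_ω x = x ⋆ (ω^{g−1}/(g−1)!)` FOR EVERY `x ∈ H•(X) = ⋀W`** — the dual Lefschetz operator of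
the (principal) polarization `ω` is the Pontryagin product with the curve class `ω^{g−1}/(g−1)!`, an algebraic 1-cycle; in particular
`Λ` is induced by an algebraic (Lefschetz) correspondence — the standard conjecture `B(A)` for abelian varieties. Proof: for `x ∈ ⋀ᵖW`
and all `z`, `τ(z ∧ Λx) = τ(Λz ∧ x) = (θ(x) ∘ Λ)(z) = (Φ(ω^∨) ⋆ θ(x))(z) = (θ(D) ⋆ θ(x))(z) = θ(D ⋆ x)(z) = τ(z ∧ (x ⋆ D))` (§1, row g36-#7
§4, Prop. 2.5.13 with `deg D = 2g − 2` even, graded commutativity of `⋆`), and Poincaré duality is perfect.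
[cite: Milne2002Polarizations, p. 600 ("known for abelian varieties (Lieberman 1968, Kleiman 1968)")] [cite: Voisin2002, §6.2.1 Lemma 6.19]
[cite: Lange2023AbelianVarietiesComplex, §2.5.3 Prop. 2.5.13 (p0134) and §1.1 Exercise 1.1.6 (11) (p0028)] -/
theorem IsSymplectic.lefschetzDual_apply_eq_pontryagin (hω : IsSymplectic ω g) (hg : 0 < g) (x : ExteriorAlgebra K W) :
    lefschetzDual ω g x = hω.pontryagin x (((g - 1)! : K)⁻¹ • ω ^ (g - 1)) := by
  obtain ⟨b, hb⟩ := id hω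
  have hD : ((g - 1)! : K)⁻¹ • ω ^ (g - 1) ∈ ⋀[K]^(2 * (g - 1)) W := Submodule.smul_mem _ _ (pow_mem_exteriorPower hω.mem (g - 1))
  induction x using DirectSum.Decomposition.inductionOn (fun i : ℕ ↦ ⋀[K]^i W) with
  | zero => rw [map_zero, map_zero, LinearMap.zero_apply]
  | add x y hx hy => rw [map_add, map_add, LinearMap.add_apply, hx, hy]
  | @homogeneous p x =>
    -- `θ(x ⋆ D) = θ(x) ∘ Λ`
    have key := hω.trace_comp_mulRight_pontryagin_eq_dualConv hD x.2
    rw [Even.neg_one_pow ⟨(g - 1) * p, by ring⟩, one_smul, hω.trace_comp_mulRight_inv_factorial_smul_pow_pred hg b hb,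
      ← hω.comp_lefschetzDual_eq_dualConv b hb, hω.pontryagin_comm_of_mem hD x.2, Even.neg_one_pow ⟨(g - 1) * p, by ring⟩,
      one_smul] at key
    refine sub_eq_zero.mp (hω.eq_zero_of_forall_trace_mul_eq_zero' fun z ↦ ?_)
    have hz := LinearMap.congr_fun key z
    rw [LinearMap.comp_apply, LinearMap.mulRight_apply, LinearMap.comp_apply, LinearMap.comp_apply, LinearMap.mulRight_apply,
      hω.trace_lefschetzDual_mul hg] at hz
    rw [mul_sub, map_sub, sub_eq_zero, hz]

/-- **`Λ_ω = (· ⋆ ω^{g−1}/(g−1)!)` as operators on `H•(X)`.** [cite: Milne2002Polarizations, p. 600] [cite: Voisin2002, §6.2.1 Lemma 6.19] -/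
theorem IsSymplectic.lefschetzDual_eq_flip_pontryagin (hω : IsSymplectic ω g) (hg : 0 < g) :
    lefschetzDual ω g = (hω.pontryagin).flip (((g - 1)! : K)⁻¹ • ω ^ (g - 1)) :=
  LinearMap.ext fun x ↦ by rw [LinearMap.flip_apply, hω.lefschetzDual_apply_eq_pontryagin hg]

/-- **`Λ_ω x = (ω^{g−1}/(g−1)!) ⋆ x`** (the curve class has even degree, so `⋆` with it commutes with everything: row g35-#2
`pontryagin_comm_of_mem`). [cite: Milne2002Polarizations, p. 600] [cite: Lange2023AbelianVarietiesComplex, §2.5.3 Lemma 2.5.11 (p0133)] -/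
theorem IsSymplectic.lefschetzDual_apply_eq_pontryagin' (hω : IsSymplectic ω g) (hg : 0 < g) (x : ExteriorAlgebra K W) :
    lefschetzDual ω g x = hω.pontryagin (((g - 1)! : K)⁻¹ • ω ^ (g - 1)) x := by
  have hD : ((g - 1)! : K)⁻¹ • ω ^ (g - 1) ∈ ⋀[K]^(2 * (g - 1)) W := Submodule.smul_mem _ _ (pow_mem_exteriorPower hω.mem (g - 1))
  rw [hω.lefschetzDual_apply_eq_pontryagin hg]
  induction x using DirectSum.Decomposition.inductionOn (fun i : ℕ ↦ ⋀[K]^i W) with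
  | zero => rw [map_zero, map_zero, LinearMap.zero_apply]
  | add x y hx hy => rw [map_add, map_add, LinearMap.add_apply, hx, hy]
  | @homogeneous p x => rw [hω.pontryagin_comm_of_mem x.2 hD, Even.neg_one_pow ⟨p * (g - 1), by ring⟩, one_smul]

end ExteriorLefschetz

end Literature.AlgebraicGeometry.Motives
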